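import Literature.MathematicalPhysics.QuantumFieldTheory.ONVectorNonVacuity
import Literature.MathematicalPhysics.QuantumFieldTheory.ONMixedSumRule
import Literature.MathematicalPhysics.QuantumFieldTheory.ConformalBootstrap3D.MeanFieldDecompositionAB
import HarnessLib

/-!
# Non-vacuity of the `O(N)` archipelago system on the open quadrant `Δ_φ, Δ_s > 1/2`: `N + 1` decoupled
# generalised free fields solve the seven Kos–Poland–Simmons-Duffin–Vichi equations with non-negative
# weights, so no seven-component point functional satisfies the §2.2 conditions on a spectrum containing them

Topic `MathematicalPhysics/QuantumFieldTheory`; definitions + theorems only (no named fact, no instance, no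
`sorry`, no new axiom).  The companion of `ONMixedSumRule.lean` [KosPolandSimmonsDuffinVichi2015] exactly as
`ONVectorNonVacuity.lean` is the companion of `ONVectorSumRule.lean` [KosPolandSimmonsduffin2014ON], and the
`O(N) ⊕ singlet` analogue of the `σ–ε` witnesses `ConformalBootstrap3D/DecoupledPairNonVacuity.lean` (equal
dimensions) and `ConformalBootstrap3D/MeanFieldDecompositionAB.lean` (the quadrant): it supplies, for the
seven-equation system at ANY external dimensions `(Δ_φ, Δ_s) = (p, q)` with `p, q > 1/2`, an explicit solution
with non-negative weights built from TYPED 3D blocks, and the consequent impossibility of an excluding point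
functional (`ONMixedSumRule.false_of_pointFunctional₇`) on any assumed spectrum containing that solution.
Honest framing: this file is bookkeeping over published material (the seven equations and functional
conditions of [KosPolandSimmonsDuffinVichi2015, §2.1–2.2], the generalised free `O(N)` correlator of
[HenrikssonVanLoon2018, §2], the generalised-free block decompositions of [FitzpatrickKaplan2012, §2.2] in the
blocks of [DolanOsborn2004, §3] as formalised under `ConformalBootstrap3D/`); it serves shared numerical engines
whose rigour lives in their verifiers, and every published number belongs to a client cell's ledger, not to
this file — no bound, island or exclusion plot is asserted or touched here.

SOURCES (held texts `paper:arxiv-1504.07997` = [KosPolandSimmonsDuffinVichi2015], `paper:arxiv-1801.03512`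
= [HenrikssonVanLoon2018]; the quotations are the ones already carried verbatim by `ONMixedSumRule.lean` and
`ONVectorNonVacuity.lean`):
* [KosPolandSimmonsDuffinVichi2015, §2]: the four-point function of scalars of dimensions `Δ_i` is expanded as
  `x₁₂^{−Δ_i−Δ_j} x₃₄^{−Δ_k−Δ_l} (x₂₄/x₁₄)^{Δ_ij} (x₁₄/x₁₃)^{Δ_kl} Σ_𝒪 λ_{ij𝒪}λ_{kl𝒪} g^{Δ_ij,Δ_kl}_{Δ,ℓ}(u,v)` and
  crossing `(1,i) ↔ (3,k)` reads `v^{(Δ_k+Δ_j)/2} G_{ijkl}(u,v) = u^{(Δ_i+Δ_j)/2} G_{kjil}(v,u)` — the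
  tree's `MixedCrossingAt`.
* [KosPolandSimmonsDuffinVichi2015, §2.1]: the seven equations and the vectors `V⃗_T, V⃗_A, V⃗_V, V⃗_S`
  (`V⃗_V = (0,0,0,0, F^{φs,φs}_-, (−1)^ℓ F^{sφ,φs}_-, −(−1)^ℓ F^{sφ,φs}_+)ᵀ`), and the footnote "we are
  following the conformal block conventions of [Kos–Poland–Simmons-Duffin 2014, Ising], which contain a factor
  of `(−1)^ℓ` relative to the conventions used in the previous global symmetry studies … This leads to a
  different sign in front of the contributions of the `𝒪_A` operators" — the tree's `SystemCrossingAt`,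
  `V7T`, `V7A`, `V7V`, `alphaVS`, `pointFunctional₇`, `false_of_pointFunctional₇`.
* [KosPolandSimmonsDuffinVichi2015, §2.2]: the functional conditions `(1 1) α⃗·V⃗_{S,0,0} (1 1)ᵀ ≥ 0` (here
  `> 0`, the normalisation used by `false_of_pointFunctional₇`), `α⃗·V⃗_T ≥ 0` (`ℓ` even), `α⃗·V⃗_A ≥ 0`
  (`ℓ` odd), `α⃗·V⃗_V ≥ 0` (any `ℓ`), `α⃗·V⃗_S ⪰ 0` (`ℓ` even).
* [HenrikssonVanLoon2018, §2]: the generalised free `O(N)` vector field, `𝒢^{(0)}_S = 1 + (u^{Δφ}/N)(1 + v^{−Δφ})`,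
  `𝒢^{(0)}_{T/A} = u^{Δφ}(1 ± v^{−Δφ})`, double twists of even spin in `S, T` and odd spin in `A` — formalised
  in `ONVectorNonVacuity.lean` (`gffS`, `gffT`, `gffA`, `crossingAt_gff`, `hasSum_gffS/T/A`), imported, not
  re-proved.
* [FitzpatrickKaplan2012, §2.2] via `MeanFieldAllSpins.lean`: `P_{n,ℓ}(p) ≥ 0` (`mftCoeff_nonneg`) and the
  equal-dimension decomposition `Σ 2P_{n,2m} g_{2p+2n+2m,2m} = u^p + (u/v)^p` (`hasSum_gff_blocks`), `1/2 < p`,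
  typed blocks `g = hrBlock` [HogervorstRychkov2013].
* [FitzpatrickKaplan2012, §2.2] and [DolanOsborn2004, §3 eqs. (3.10)–(3.11)] via `MeanFieldCoefficientsAB.lean`,
  `BlockExistenceAB.lean`, `MeanFieldDecompositionAB.lean`: the unequal-dimension coefficients
  `P_{n,ℓ}(p,q) ≥ 0` (`mftCoeffAB_nonneg`; `mftCoeffAB_self`: `P_{n,ℓ}(p,p) = P_{n,ℓ}(p)`), the typed blocks
  `g^{Δ₁₂,Δ₃₄}_{Δ,ℓ} = hrBlockAB Δ₁₂ Δ₃₄ Δ ℓ` (`hrBlockAB_zero_zero`: `= hrBlock` at `Δ₁₂ = Δ₃₄ = 0`;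
  `isConformalBlock3DAbove_hrBlockAB`), and the two kernel-checked decompositions of a decoupled pair of
  dimensions `(p, q)`, `p, q > 1/2`, on the open square:
  (I) `Σ_{n,ℓ} (−1)^ℓ P_{n,ℓ}(p,q) g^{p−q,p−q}_{p+q+2n+ℓ,ℓ} = u^{(p+q)/2}` (`hasSum_gffPair_blocks_I`, `⟨φsφs⟩`),
  (II) `Σ_{n,ℓ} P_{n,ℓ}(p,q) g^{−(p−q),p−q}_{p+q+2n+ℓ,ℓ} = u^{(p+q)/2} v^{−p}` (`hasSum_gffPair_blocks_II`, `⟨sφφs⟩`).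

THE WITNESS (§1–§3).  `N` decoupled generalised free fields `φ_i` of dimension `p` and one more, `s`, of
dimension `q`, `p, q > 1/2` — the whole open quadrant of the `(Δ_φ, Δ_s)` plane strictly above the scalar
unitarity bound.  Channel sums (§1): `G^{φφ}_S = gffS`, `G_T = gffT`, `G_A = gffAsrc = ½(u^p − (u/v)^p) = −gffA`
(the source's antisymmetric structure is `−tA`, `ONMixedSumRule.crossingPhi4At_iff`), `G^{ss}_S = gff1 q =
1 + u^q + (u/v)^q`, `G^{φs}_S ≡ 1` (`unitOnly`: in `⟨φᵢφⱼss⟩` only the disconnected pairing survives),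
`G_{V,1} = u^{(p+q)/2}` (`⟨φᵢsφⱼs⟩`, dimensions `(p,q,p,q)`: the pairing `(13)(24)` against the source's
prefactor), `G_{V,2} = u^{(p+q)/2} v^{−p}` (`⟨sφⱼφᵢs⟩`, dimensions `(q,p,p,q)`: the pairing `(14)(23)`);
`systemCrossingAt_gff`: all five clauses of `SystemCrossingAt N p q` hold at every `u, v > 0`, for every `N`.
Blocks (§2): the system is written in the source's convention, so the typed blocks enter as
`srcBlockUV Δ ℓ = (−1)^ℓ · blockUV Δ ℓ` and `srcBlockUVAB Δ₁₂ Δ₃₄ Δ ℓ = (−1)^ℓ · blockUVAB Δ₁₂ Δ₃₄ Δ ℓ`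
(`blockUV` = `hrBlock`, `blockUVAB` = `hrBlockAB` through the root map of `ONVectorNonVacuity`; these carry the
older convention, in which `ONVectorNonVacuity.hasSum_gffA` has positive weights on `+blockUV`;
`blockUVAB_zero_zero`: the two families agree at `Δ₁₂ = Δ₃₄ = 0`).  Decompositions with NON-NEGATIVE weights
(§3), all at diamond points `InDiamond u v`: singlet sector indexed by `(ℕ × ℕ) ⊕ (ℕ × ℕ)` — `[φₖφₖ]_{n,2m}` at
`(2p+2n+2m, 2m)` with couplings `(λ_{φφ𝒪}, λ_{ss𝒪}) = (√(2P_{n,2m}(p)/N), 0)` and `[ss]_{n,2m}` at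
`(2q+2n+2m, 2m)` with `(0, √(2P_{n,2m}(q)))` (`hasSum_singlet_phiphi/phis/ss`); `T`: `P_{n,2m}(p)` on
`g_{2p+2n+2m,2m}` (`hasSum_gffT`); `A`: `P_{n,2m+1}(p)` on `srcBlockUV = −blockUV` at `(2p+2n+2m+1, 2m+1)`
(`hasSum_gffAsrc` — the footnote's sign, kernel-checked); `V`: `[φᵢ s]_{n,ℓ}` of ALL spins at `(p+q+2n+ℓ, ℓ)`
with `λ² = P_{n,ℓ}(p,q)`, `ε = (−1)^ℓ`, `g₁ = g^{src; p−q, p−q}`, `g₂ = g^{src; −(p−q), p−q}` (`hasSum_gffV1`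
from (I): `Σ P · g^{src} = Σ (−1)^ℓ P · blockUVAB = u^{(p+q)/2}`; `hasSum_gffV2` from (II):
`Σ P (−1)^ℓ g^{src} = Σ P · blockUVAB = u^{(p+q)/2} v^{−p}` — the placement of `(−1)^ℓ` inside `V⃗_V` and the
`(Δ₁₂, Δ₃₄)` labels of its two rows are exactly what lets both come out with the same non-negative `λ²`).

RESULTS (§4).
* `not_pointFunctional₇_excludes_gff` — for `2 ≤ N`, `1/2 < p`, `1/2 < q`, any `M`, weights
  `w : Fin M → Fin 7 → ℝ` and diamond points: NOT (unit condition `> 0` ∧ `α⃗·V⃗_S[g] ⪰ 0` on both singlet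
  double-twist families ∧ `α⃗·V⃗_T[g] ≥ 0` on `(2p+2n+2m, 2m)` ∧ `α⃗·V⃗_A[g^{src}] ≥ 0` on the odd double
  twists ∧ `α⃗·V⃗_V[(−1)^ℓ; g₁^{src}, g₂^{src}] ≥ 0` on the bi-fundamental double twists) — by
  `false_of_pointFunctional₇` fed with the fourteen `HasSum` families above and `systemCrossingAt_gff`.
* `false_of_pointFunctional₇_allowing_gff` — the same for arbitrary per-sector spectrum predicates
  `P_S, P_T, P_A, P_V : ℝ → ℕ → Prop` admitting those families (`srcBlockUV_two_mul`: for even spins the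
  conventions agree).
* `false_of_pointFunctional₇_gaps_le` — the gap form: `S`/`T` even spins above unitarity with scalar gaps
  `Δ_S^* ≤ min(2p, 2q)`, `Δ_T^* ≤ 2p`, `A` odd spins above unitarity, `V` all spins above unitarity with scalar
  gap `Δ_V^* ≤ p + q` ⇒ no such functional; `false_of_pointFunctional₇_gaps_le_diag`: the diagonal `q = p`,
  where both `V` rows carry the `Δ₁₂ = Δ₃₄ = 0` block `srcBlockUV` (`srcBlockUVAB_zero_zero`).

WHAT THIS SERVES / DOES NOT.  (i) A planted-TRUE control for certificate readers of the seven-equation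
system on the whole quadrant: a certificate claiming to exclude `(Δ_φ, Δ_s) = (p, q)` under assumptions
admitting the decoupled families is invalid, whatever its numerics.  (ii) A kernel-level consistency audit of
the conventions fixed in `ONMixedSumRule.lean` (the `−tA` structure, `ε = (−1)^ℓ` inside `V⃗_V`, the
`(Δ₁₂, Δ₃₄)` labels `(Δ_φs, Δ_φs)` and `(Δ_sφ, Δ_φs)` of its two rows, the `½` off-diagonal of `V⃗_S`, the
prefactor exponents `Δ_φ`, `Δ_s`, `(Δ_φ+Δ_s)/2`): one explicit datum meets all five crossing clauses and all
fourteen decompositions with non-negative weights simultaneously, for independent `p` and `q`.  NOT covered: the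
boundary `p = 1/2` or `q = 1/2` (free fields; the tree's decompositions require `> 1/2`); and nothing here bears
on the archipelago itself: with the source's gaps `Δ_S^* = Δ_V^* = 3 > 2Δ_φ, Δ_φ + Δ_s` the decoupled data are
legitimately excluded from the assumptions, and that exclusion is a genuine one.
-/

namespace Literature.MathematicalPhysics.QuantumFieldTheory.ONMixedNonVacuity

open Set Matrix Literature.MathematicalPhysics.QuantumFieldTheory.ONVectorSumRule
  Literature.MathematicalPhysics.QuantumFieldTheory.ONMixedSumRule
  Literature.MathematicalPhysics.QuantumFieldTheory.ONVectorNonVacuity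
  Literature.MathematicalPhysics.QuantumFieldTheory.ConformalBootstrap3D

noncomputable section

variable {N : ℕ}

/-! ## §1 The seven channel sums of `N + 1` decoupled generalised free fields of dimensions `p` (`φᵢ`) and `q` (`s`) -/

/-- `⟨ssss⟩` of a single generalised free field `s` of dimension `q`, unit included:
`G^{ss}_S = 1 + u^q + (u/v)^q`. [cite: HenrikssonVanLoon2018, §2 (generalized free correlator, N = 1)]
[cite: FitzpatrickKaplan2012, §2.2] -/
def gff1 (q : ℝ) (u v : ℝ) : ℝ := 1 + (u ^ q + u ^ q / v ^ q)

/-- The antisymmetric channel sum of the `O(N)` generalised free vector field IN THE SOURCE'S BLOCK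
CONVENTION (antisymmetric structure `δᵢₖδⱼₗ − δᵢₗδⱼₖ = −tA`, footnote of §2.1): `G_A = ½(u^p − (u/v)^p) = −gffA`.
[cite: KosPolandSimmonsDuffinVichi2015, §2.1 (footnote on conventions)] [cite: HenrikssonVanLoon2018, §2 (𝒢^{(0)}_A)] -/
def gffAsrc (p : ℝ) (u v : ℝ) : ℝ := (u ^ p - u ^ p / v ^ p) / 2

/-- `⟨φᵢ s φⱼ s⟩` of decoupled generalised free `φ` (dimension `p`) and `s` (dimension `q`), `(12)(34)` channel,
stripped of `δᵢⱼ` and of the source's prefactor `x₁₂^{−p−q} x₃₄^{−p−q} (x₂₄/x₁₄)^{p−q} (x₁₄/x₁₃)^{p−q}`: only the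
Wick pairing `(13)(24)` survives, `G_{V,1} = u^{(p+q)/2}`.
[cite: KosPolandSimmonsDuffinVichi2015, §2 (crossing equation)] [cite: FitzpatrickKaplan2012, §2.2] -/
def gffV1 (p q : ℝ) (u _v : ℝ) : ℝ := u ^ ((p + q) / 2)

/-- `⟨s φⱼ φᵢ s⟩` (the crossed correlator, dimensions `(q,p,p,q)`), `(12)(34)` channel: only the pairing
`(14)(23)` survives, `G_{V,2} = u^{(p+q)/2} v^{−p}`.
[cite: KosPolandSimmonsDuffinVichi2015, §2 (crossing equation)] [cite: FitzpatrickKaplan2012, §2.2] -/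
def gffV2 (p q : ℝ) (u v : ℝ) : ℝ := u ^ ((p + q) / 2) / v ^ p

/-- `⟨φᵢφⱼ s s⟩`, `(12)(34)` channel, stripped of `δᵢⱼ`: only the disconnected pairing `(12)(34)` survives — the
singlet channel sum `G^{φs}_S = Σ λ_{φφ𝒪} λ_{ss𝒪} g_𝒪` is the unit operator alone, `≡ 1`.
[cite: KosPolandSimmonsDuffinVichi2015, §2.1 (four-point functions `⟨φφss⟩`, `⟨ssss⟩`)] -/
def unitOnly : ℝ → ℝ → ℝ := fun _ _ => 1

/-- Dictionary to `ONVectorNonVacuity`: `−G_A^{source} = gffA`. [cite: KosPolandSimmonsDuffinVichi2015, §2.1 (footnote on conventions)] -/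
theorem neg_gffAsrc (p : ℝ) : -gffAsrc p = gffA p := by
  funext u v
  simp only [Pi.neg_apply, gffAsrc, gffA]
  ring

/-- **The decoupled generalised free data are crossing symmetric for the whole system**
(`SystemCrossingAt N p q`): `⟨φφφφ⟩` (rows 1–3, via `crossingAt_gff` and the `G_A ↦ −G_A` dictionary),
`⟨ssss⟩` (exponent `q`), `⟨φsφs⟩` (exponent `(p+q)/2`), and `⟨φφss⟩` at `(u,v)` and `(v,u)` (exponents
`(p+q)/2`, `p`) — at every `u, v > 0`, for every `N`.
[cite: KosPolandSimmonsDuffinVichi2015, §2.1 (seven equations)] [cite: HenrikssonVanLoon2018, §2] -/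
theorem systemCrossingAt_gff (N : ℕ) (p q : ℝ) {u v : ℝ} (hu : 0 < u) (hv : 0 < v) :
    SystemCrossingAt N p q (gffS N p) (gff1 q) unitOnly (gffT p) (gffAsrc p) (gffV1 p q) (gffV2 p q)
      u v := by
  have hup : 0 < u ^ p := Real.rpow_pos_of_pos hu p
  have hvp : 0 < v ^ p := Real.rpow_pos_of_pos hv p
  have huq : 0 < u ^ q := Real.rpow_pos_of_pos hu q
  have hvq : 0 < v ^ q := Real.rpow_pos_of_pos hv q
  refine ⟨?_, ?_, ?_, ?_, ?_⟩
  · rw [crossingPhi4At_iff, neg_gffAsrc]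
    exact crossingAt_gff N p hu hv
  · simp only [MixedCrossingAt, gff1]
    field_simp
    ring
  · simp only [MixedCrossingAt, gffV1]
    ring
  · simp only [MixedCrossingAt, unitOnly, gffV2]
    field_simp
  · simp only [MixedCrossingAt, unitOnly, gffV2]
    field_simp

/-! ## §2 Typed blocks in the source's `(−1)^ℓ` convention -/

/-- The typed 3D block read as a channel function of `(u,v)`, in the SOURCE's convention: a factor `(−1)^ℓ`
relative to the blocks of the 2014 `O(N)` paper (footnote of §2.1), i.e. `g^{src}_{Δ,ℓ} = (−1)^ℓ · blockUV Δ ℓ`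
(`blockUV` carries the 2014 convention: `ONVectorNonVacuity.hasSum_gffA` has positive weights on it).
[cite: KosPolandSimmonsDuffinVichi2015, §2.1 (footnote on conventions)] -/
def srcBlockUV (Δ : ℝ) (ℓ : ℕ) (u v : ℝ) : ℝ := (-1 : ℝ) ^ ℓ * blockUV Δ ℓ u v

/-- Even spins: the two conventions agree. [cite: KosPolandSimmonsDuffinVichi2015, §2.1 (footnote on conventions)] -/
theorem srcBlockUV_two_mul (Δ : ℝ) (m : ℕ) : srcBlockUV Δ (2 * m) = blockUV Δ (2 * m) := by
  funext u v
  simp [srcBlockUV, (even_two_mul m).neg_one_pow]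

/-- Odd spins: a sign. [cite: KosPolandSimmonsDuffinVichi2015, §2.1 (footnote on conventions)] -/
theorem srcBlockUV_two_mul_add_one (Δ : ℝ) (m : ℕ) :
    srcBlockUV Δ (2 * m + 1) = -blockUV Δ (2 * m + 1) := by
  funext u v
  simp [srcBlockUV, (odd_two_mul_add_one m).neg_one_pow]

/-- The typed 3D block for unequal external dimensions `g^{Δ₁₂,Δ₃₄}_{Δ,ℓ}` (`hrBlockAB`, the Dolan–Osborn
`z`-series normalised by `k_{ℓ0} = 1`) read as a channel function of `(u,v)` through the root map of
`ONVectorNonVacuity` (older sign convention, like `blockUV`).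
[cite: DolanOsborn2004, §3 eqs. (3.10)–(3.11)] [cite: KosPolandSimmonsDuffinVichi2015, §2 (crossing equation)] -/
def blockUVAB (Δ₁₂ Δ₃₄ Δ : ℝ) (ℓ : ℕ) (u v : ℝ) : ℝ := hrBlockAB Δ₁₂ Δ₃₄ Δ ℓ (zOfUV u v) (zbOfUV u v)

/-- The same block in the SOURCE's convention: `g^{src; Δ₁₂,Δ₃₄}_{Δ,ℓ} = (−1)^ℓ · blockUVAB Δ₁₂ Δ₃₄ Δ ℓ`.
[cite: KosPolandSimmonsDuffinVichi2015, §2.1 (footnote on conventions)] [cite: DolanOsborn2004, §3 eqs. (3.10)–(3.11)] -/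
def srcBlockUVAB (Δ₁₂ Δ₃₄ Δ : ℝ) (ℓ : ℕ) (u v : ℝ) : ℝ := (-1 : ℝ) ^ ℓ * blockUVAB Δ₁₂ Δ₃₄ Δ ℓ u v

/-- At `Δ₁₂ = Δ₃₄ = 0` the two block families agree (`hrBlockAB_zero_zero`). [cite: DolanOsborn2004, §3 eq. (3.11)] -/
theorem blockUVAB_zero_zero (Δ : ℝ) (ℓ : ℕ) : blockUVAB 0 0 Δ ℓ = blockUV Δ ℓ := by
  funext u v
  simp only [blockUVAB, blockUV, hrBlockAB_zero_zero]

/-- At `Δ₁₂ = Δ₃₄ = 0`, in the source's convention: `srcBlockUVAB 0 0 = srcBlockUV`.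
[cite: DolanOsborn2004, §3 eq. (3.11)] [cite: KosPolandSimmonsDuffinVichi2015, §2.1 (footnote on conventions)] -/
theorem srcBlockUVAB_zero_zero (Δ : ℝ) (ℓ : ℕ) : srcBlockUVAB 0 0 Δ ℓ = srcBlockUV Δ ℓ := by
  funext u v
  simp only [srcBlockUVAB, srcBlockUV, blockUVAB_zero_zero]

/-- Every block of the two `V`-row families is a typed block (`IsConformalBlock3DAbove`) at a point
`(p+q+2n+ℓ, ℓ)` strictly above the 3D unitarity bound, for `p, q > 1/2`.
[cite: DolanOsborn2004, §3 eqs. (3.9)–(3.12)] [cite: FitzpatrickKaplan2012, §2.2] -/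
theorem gffV_blocks_typed {p q : ℝ} (hp : 1 / 2 < p) (hq : 1 / 2 < q) (n ℓ : ℕ) :
    unitarityBound3D ℓ < p + q + 2 * n + ℓ ∧
      IsConformalBlock3DAbove (p - q) (p - q) (p + q + 2 * n + ℓ) ℓ
        (hrBlockAB (p - q) (p - q) (p + q + 2 * n + ℓ) ℓ) ∧
      IsConformalBlock3DAbove (-(p - q)) (p - q) (p + q + 2 * n + ℓ) ℓ
        (hrBlockAB (-(p - q)) (p - q) (p + q + 2 * n + ℓ) ℓ) := by
  have h := pair_unitarity' hp hq n ℓ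
  have e : 2 * ((p + q) / 2) + 2 * (n : ℝ) + (ℓ : ℝ) = p + q + 2 * n + ℓ := by ring
  rw [e] at h
  exact ⟨h, isConformalBlock3DAbove_hrBlockAB h, isConformalBlock3DAbove_hrBlockAB h⟩

/-! ## §3 The channel decompositions with non-negative weights -/

section Decompositions

variable {p q u v : ℝ}

/-- `⟨ssss⟩`: `G^{ss}_S − 1 = Σ_{n,m} 2P_{n,2m}(q) g_{2q+2n+2m,2m}` at a diamond point (the tree's
`hasSum_gff_blocks` read through the root map). [cite: FitzpatrickKaplan2012, §2.2] -/
theorem hasSum_gff1 (hq : 1 / 2 < q) (h : InDiamond u v) :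
    HasSum (fun nm : ℕ × ℕ => gffOPECoeffSq q nm *
        blockUV (2 * q + 2 * nm.1 + 2 * nm.2) (2 * nm.2) u v) (gff1 q u v - 1) := by
  obtain ⟨hz, hzb, hprod, hprod'⟩ := h.roots
  have hs := hasSum_gff_blocks hq hz hzb
  have hval : meanFieldCorrelator q (zOfUV u v) (zbOfUV u v) = gff1 q u v - 1 := by
    rw [meanFieldCorrelator, hprod, hprod', gff1]
    ring
  rw [hval] at hs
  exact hs

/-- Antisymmetric channel in the source's convention: `G_A = ½(u^p − (u/v)^p) = Σ_{n,m} P_{n,2m+1}(p) g^{src}_{2p+2n+2m+1,2m+1}`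
— odd spins, the SAME positive mean-field weights, now on the source-convention blocks `g^{src} = −blockUV`:
the footnote's "different sign in front of the contributions of the `𝒪_A` operators", kernel-checked.
[cite: KosPolandSimmonsDuffinVichi2015, §2.1 (footnote on conventions)] [cite: FitzpatrickKaplan2012, §2.2] -/
theorem hasSum_gffAsrc (hp : 1 / 2 < p) (h : InDiamond u v) :
    HasSum (fun nm : ℕ × ℕ => mftCoeff p nm.1 (2 * nm.2 + 1) *
        srcBlockUV (2 * p + 2 * (nm.1 : ℕ) + ((2 * nm.2 + 1 : ℕ) : ℝ)) (2 * nm.2 + 1) u v) (gffAsrc p u v) := by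
  have hs := (hasSum_gffA hp h).neg
  have hval : -gffA p u v = gffAsrc p u v := by rw [gffA, gffAsrc]; ring
  rw [hval] at hs
  refine hs.congr_fun fun nm => ?_
  rw [srcBlockUV_two_mul_add_one]
  simp only [Pi.neg_apply]
  ring

/-- `⟨φsφs⟩`: `G_{V,1} = u^{(p+q)/2} = Σ_{n,ℓ} P_{n,ℓ}(p,q) g^{src; p−q,p−q}_{p+q+2n+ℓ,ℓ}` over ALL spins with
positive weights (the tree's signed decomposition (I), `hasSum_gffPair_blocks_I`, in the source convention).
[cite: FitzpatrickKaplan2012, §2.2] [cite: KosPolandSimmonsDuffinVichi2015, §2.1 (`V⃗_V`)] -/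
theorem hasSum_gffV1 (hp : 1 / 2 < p) (hq : 1 / 2 < q) (h : InDiamond u v) :
    HasSum (fun nl : ℕ × ℕ => mftCoeffAB p q nl.1 nl.2 *
        srcBlockUVAB (p - q) (p - q) (p + q + 2 * nl.1 + nl.2) nl.2 u v) (gffV1 p q u v) := by
  obtain ⟨hz, hzb, hprod, -⟩ := h.roots
  have hs := hasSum_gffPair_blocks_I hp hq hz hzb
  rw [hprod] at hs
  refine hs.congr_fun fun nl => ?_
  simp only [srcBlockUVAB, blockUVAB]
  ring

/-- `⟨sφφs⟩`: `G_{V,2} = Σ ε λ² g₂ = u^{(p+q)/2} v^{−p}` with `ε = (−1)^ℓ`, the same weights `P_{n,ℓ}(p,q)` and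
the source-convention blocks `g₂ = g^{src; −(p−q),p−q}`: `Σ_{n,ℓ} P_{n,ℓ} (−1)^ℓ g^{src}_{p+q+2n+ℓ,ℓ} =
Σ P_{n,ℓ} blockUVAB = u^{(p+q)/2} v^{−p}` (decomposition (II), `hasSum_gffPair_blocks_II`) — the placement of
`(−1)^ℓ` inside `V⃗_V` is consistent with non-negative `λ²_{φs𝒪}`.
[cite: KosPolandSimmonsDuffinVichi2015, §2.1 (`V⃗_V`)] [cite: FitzpatrickKaplan2012, §2.2] -/
theorem hasSum_gffV2 (hp : 1 / 2 < p) (hq : 1 / 2 < q) (h : InDiamond u v) :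
    HasSum (fun nl : ℕ × ℕ => mftCoeffAB p q nl.1 nl.2 * (-1 : ℝ) ^ nl.2 *
        srcBlockUVAB (-(p - q)) (p - q) (p + q + 2 * nl.1 + nl.2) nl.2 u v) (gffV2 p q u v) := by
  obtain ⟨hz, hzb, hprod, hprod'⟩ := h.roots
  have hs := hasSum_gffPair_blocks_II hp hq hz hzb
  rw [hprod, hprod'] at hs
  refine hs.congr_fun fun nl => ?_
  have hsq : (-1 : ℝ) ^ nl.2 * (-1 : ℝ) ^ nl.2 = 1 := by
    rw [← mul_pow]
    norm_num
  simp only [srcBlockUVAB, blockUVAB]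
  linear_combination (mftCoeffAB p q nl.1 nl.2 *
    hrBlockAB (-(p - q)) (p - q) (p + q + 2 * nl.1 + nl.2) nl.2 (zOfUV u v) (zbOfUV u v)) * hsq

/-! ### The singlet sector: `[φφ]_{n,2m}` (couplings `(√(2P(p)/N), 0)`) ⊔ `[ss]_{n,2m}` (couplings `(0, √(2P(q)))`) -/

/-- Channel functions of the singlet sector, indexed by `(ℕ × ℕ) ⊕ (ℕ × ℕ)`: `inl (n,m)` = the `O(N)`-singlet
double twist `[φₖφₖ]_{n,2m}` at `(2p+2n+2m, 2m)`, `inr (n,m)` = `[ss]_{n,2m}` at `(2q+2n+2m, 2m)`; blocks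
`g^{0,0} = blockUV`. [cite: KosPolandSimmonsDuffinVichi2015, §2.1 (`V⃗_S`)] -/
def singletBlock (p q : ℝ) (o : (ℕ × ℕ) ⊕ (ℕ × ℕ)) : ℝ → ℝ → ℝ :=
  Sum.elim (fun nm : ℕ × ℕ => blockUV (2 * p + 2 * nm.1 + 2 * nm.2) (2 * nm.2))
    (fun nm : ℕ × ℕ => blockUV (2 * q + 2 * nm.1 + 2 * nm.2) (2 * nm.2)) o

/-- `λ_{φφ𝒪}` on the singlet sector: `√(2P_{n,2m}(p)/N)` on `[φφ]`, `0` on `[ss]` (decoupling).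
[cite: KosPolandSimmonsDuffinVichi2015, §2.1 (`V⃗_S`)] [cite: FitzpatrickKaplan2012, §2.2] -/
def lamPhiPhi (N : ℕ) (p : ℝ) : (ℕ × ℕ) ⊕ (ℕ × ℕ) → ℝ :=
  Sum.elim (fun nm => Real.sqrt (gffOPECoeffSq p nm / N)) (fun _ => 0)

/-- `λ_{ss𝒪}` on the singlet sector: `0` on `[φφ]`, `√(2P_{n,2m}(q))` on `[ss]`.
[cite: KosPolandSimmonsDuffinVichi2015, §2.1 (`V⃗_S`)] [cite: FitzpatrickKaplan2012, §2.2] -/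
def lamSS (q : ℝ) : (ℕ × ℕ) ⊕ (ℕ × ℕ) → ℝ :=
  Sum.elim (fun _ => 0) (fun nm => Real.sqrt (gffOPECoeffSq q nm))

/-- `Σ λ²_{φφ𝒪} g_𝒪 = G^{φφ}_S − 1`. [cite: KosPolandSimmonsDuffinVichi2015, §2.1 (seven equations)] -/
theorem hasSum_singlet_phiphi (N : ℕ) (hp : 1 / 2 < p) (h : InDiamond u v) :
    HasSum (fun o => lamPhiPhi N p o ^ 2 * singletBlock p q o u v) (gffS N p u v - 1) := by
  have h1 : HasSum ((fun o => lamPhiPhi N p o ^ 2 * singletBlock p q o u v) ∘ Sum.inl)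
      (gffS N p u v - 1) := by
    refine (hasSum_gffS N hp h).congr_fun fun nm => ?_
    simp only [Function.comp_apply, lamPhiPhi, singletBlock, Sum.elim_inl,
      Real.sq_sqrt (gffS_weight_nonneg N hp nm)]
  have h2 : HasSum ((fun o => lamPhiPhi N p o ^ 2 * singletBlock p q o u v) ∘ Sum.inr) 0 := by
    refine (hasSum_zero (α := ℝ) (β := ℕ × ℕ)).congr_fun fun nm => ?_
    simp [lamPhiPhi]
  simpa using h1.sum h2

/-- `Σ λ_{φφ𝒪} λ_{ss𝒪} g_𝒪 = 0 = G^{φs}_S − 1` (no operator couples to both). [cite: KosPolandSimmonsDuffinVichi2015, §2.1 (seven equations)] -/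
theorem hasSum_singlet_phis (N : ℕ) (p q : ℝ) (u v : ℝ) :
    HasSum (fun o => lamPhiPhi N p o * lamSS q o * singletBlock p q o u v) (unitOnly u v - 1) := by
  have h0 : unitOnly u v - 1 = 0 := by simp [unitOnly]
  rw [h0]
  refine (hasSum_zero (α := ℝ)).congr_fun fun o => ?_
  cases o <;> simp [lamPhiPhi, lamSS]

/-- `Σ λ²_{ss𝒪} g_𝒪 = G^{ss}_S − 1`. [cite: KosPolandSimmonsDuffinVichi2015, §2.1 (seven equations)] -/
theorem hasSum_singlet_ss (hq : 1 / 2 < q) (h : InDiamond u v) :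
    HasSum (fun o => lamSS q o ^ 2 * singletBlock p q o u v) (gff1 q u v - 1) := by
  have h1 : HasSum ((fun o => lamSS q o ^ 2 * singletBlock p q o u v) ∘ Sum.inl) 0 := by
    refine (hasSum_zero (α := ℝ) (β := ℕ × ℕ)).congr_fun fun nm => ?_
    simp [lamSS]
  have h2 : HasSum ((fun o => lamSS q o ^ 2 * singletBlock p q o u v) ∘ Sum.inr) (gff1 q u v - 1) := by
    refine (hasSum_gff1 hq h).congr_fun fun nm => ?_
    simp only [Function.comp_apply, lamSS, singletBlock, Sum.elim_inr,
      Real.sq_sqrt (gffOPECoeffSq_pos hq nm).le]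
  simpa using h1.sum h2

end Decompositions

/-! ## §4 The witness: no seven-component point functional excludes the decoupled data -/

/-- **Non-vacuity of the archipelago exclusion step on the quadrant / the planted-true control.** For
`2 ≤ N`, `p, q > 1/2`, `(Δ_φ, Δ_s) = (p, q)`, and ANY seven-component point functional `α⃗` at finitely many
diamond points, the five conditions of §2.2 cannot all hold on the decoupled generalised free data:
`(1 1) α⃗·V⃗_{S,0,0} (1 1)ᵀ > 0`, `α⃗·V⃗_S[g] ⪰ 0` on the singlet double twists `(2p+2n+2m, 2m)` and
`(2q+2n+2m, 2m)`, `α⃗·V⃗_T[g] ≥ 0` on `(2p+2n+2m, 2m)`, `α⃗·V⃗_A[g^{src}] ≥ 0` on `(2p+2n+2m+1, 2m+1)`,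
`α⃗·V⃗_V[(−1)^ℓ; g^{src; p−q,p−q}, g^{src; −(p−q),p−q}] ≥ 0` on the bi-fundamental double twists `(p+q+2n+ℓ, ℓ)`,
all spins — contradiction.
[cite: KosPolandSimmonsDuffinVichi2015, §2.2 (functional conditions)] [cite: HenrikssonVanLoon2018, §2] -/
theorem not_pointFunctional₇_excludes_gff (hN : 2 ≤ N) {p q : ℝ} (hp : 1 / 2 < p) (hq : 1 / 2 < q) {M : ℕ}
    (w : Fin M → Fin 7 → ℝ) (u v : Fin M → ℝ) (huv : ∀ m, InDiamond (u m) (v m)) :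
    ¬ (0 < ![(1 : ℝ), 1] ⬝ᵥ
          (alphaVS (pointFunctional₇ w u v) p q (fun _ _ => (1 : ℝ)) *ᵥ ![(1 : ℝ), 1]) ∧
       (∀ nm : ℕ × ℕ, (alphaVS (pointFunctional₇ w u v) p q
          (blockUV (2 * p + 2 * nm.1 + 2 * nm.2) (2 * nm.2))).PosSemidef) ∧
       (∀ nm : ℕ × ℕ, (alphaVS (pointFunctional₇ w u v) p q
          (blockUV (2 * q + 2 * nm.1 + 2 * nm.2) (2 * nm.2))).PosSemidef) ∧
       (∀ nm : ℕ × ℕ, 0 ≤ pointFunctional₇ w u v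
          (V7T N p (blockUV (2 * p + 2 * nm.1 + 2 * nm.2) (2 * nm.2)))) ∧
       (∀ nm : ℕ × ℕ, 0 ≤ pointFunctional₇ w u v
          (V7A p (srcBlockUV (2 * p + 2 * (nm.1 : ℕ) + ((2 * nm.2 + 1 : ℕ) : ℝ)) (2 * nm.2 + 1)))) ∧
       (∀ nl : ℕ × ℕ, 0 ≤ pointFunctional₇ w u v
          (V7V p q ((-1 : ℝ) ^ nl.2) (srcBlockUVAB (p - q) (p - q) (p + q + 2 * nl.1 + nl.2) nl.2)
            (srcBlockUVAB (-(p - q)) (p - q) (p + q + 2 * nl.1 + nl.2) nl.2)))) := by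
  rintro ⟨hunit, hS, hS', hT, hA, hV⟩
  exact false_of_pointFunctional₇ hN w u v (Δφ := p) (Δs := q) (a := lamPhiPhi N p) (b := lamSS q)
    (pT := fun nm : ℕ × ℕ => mftCoeff p nm.1 (2 * nm.2))
    (pA := fun nm : ℕ × ℕ => mftCoeff p nm.1 (2 * nm.2 + 1))
    (pV := fun nl : ℕ × ℕ => mftCoeffAB p q nl.1 nl.2) (ε := fun nl : ℕ × ℕ => (-1 : ℝ) ^ nl.2)
    (gS := singletBlock p q) (gT := fun nm => blockUV (2 * p + 2 * nm.1 + 2 * nm.2) (2 * nm.2))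
    (gA := fun nm => srcBlockUV (2 * p + 2 * (nm.1 : ℕ) + ((2 * nm.2 + 1 : ℕ) : ℝ)) (2 * nm.2 + 1))
    (gV₁ := fun nl => srcBlockUVAB (p - q) (p - q) (p + q + 2 * nl.1 + nl.2) nl.2)
    (gV₂ := fun nl => srcBlockUVAB (-(p - q)) (p - q) (p + q + 2 * nl.1 + nl.2) nl.2)
    (GSφφ := gffS N p) (GSss := gff1 q) (GSφs := unitOnly) (GT := gffT p) (GA := gffAsrc p)
    (GV₁ := gffV1 p q) (GV₂ := gffV2 p q)
    (fun _ => mftCoeff_nonneg hp _ _) (fun _ => mftCoeff_nonneg hp _ _)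
    (fun _ => mftCoeffAB_nonneg hp hq _ _)
    (fun m => hasSum_singlet_phiphi N hp (huv m)) (fun m => hasSum_singlet_phiphi N hp (huv m).symm)
    (fun m => hasSum_singlet_phis N p q _ _) (fun m => hasSum_singlet_phis N p q _ _)
    (fun m => hasSum_singlet_ss hq (huv m)) (fun m => hasSum_singlet_ss hq (huv m).symm)
    (fun m => hasSum_gffT hp (huv m)) (fun m => hasSum_gffT hp (huv m).symm)
    (fun m => hasSum_gffAsrc hp (huv m)) (fun m => hasSum_gffAsrc hp (huv m).symm)
    (fun m => hasSum_gffV1 hp hq (huv m)) (fun m => hasSum_gffV1 hp hq (huv m).symm)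
    (fun m => hasSum_gffV2 hp hq (huv m)) (fun m => hasSum_gffV2 hp hq (huv m).symm)
    (fun m => systemCrossingAt_gff N p q (huv m).pos.1 (huv m).pos.2)
    hunit hT hA hV (fun o => by
      cases o with
      | inl nm => exact hS nm
      | inr nm => exact hS' nm)

/-- **Corollary (assumed spectra containing the decoupled families are never excluded).** Spectrum
assumptions `P_S, P_T, P_A, P_V : ℝ → ℕ → Prop` per sector; if they admit the singlet double twists
`(2p+2n+2m, 2m)` and `(2q+2n+2m, 2m)`, the traceless ones `(2p+2n+2m, 2m)`, the antisymmetric ones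
`(2p+2n+2m+1, 2m+1)` and the bi-fundamental ones `(p+q+2n+ℓ, ℓ)` (all spins), no point functional at diamond
points satisfies the §2.2 conditions on all allowed blocks (blocks in the source's convention `g^{src}`; for
even spins `g^{src} = blockUV`). [cite: KosPolandSimmonsDuffinVichi2015, §2.2 (functional conditions)] -/
theorem false_of_pointFunctional₇_allowing_gff (hN : 2 ≤ N) {p q : ℝ} (hp : 1 / 2 < p) (hq : 1 / 2 < q)
    {M : ℕ} (w : Fin M → Fin 7 → ℝ) (u v : Fin M → ℝ) (huv : ∀ m, InDiamond (u m) (v m))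
    (PS PT PA PV : ℝ → ℕ → Prop)
    (hPS : ∀ n m : ℕ, PS (2 * p + 2 * n + 2 * m) (2 * m)) (hPS' : ∀ n m : ℕ, PS (2 * q + 2 * n + 2 * m) (2 * m))
    (hPT : ∀ n m : ℕ, PT (2 * p + 2 * n + 2 * m) (2 * m))
    (hPA : ∀ n m : ℕ, PA (2 * p + 2 * n + ((2 * m + 1 : ℕ) : ℝ)) (2 * m + 1))
    (hPV : ∀ n ℓ : ℕ, PV (p + q + 2 * n + ℓ) ℓ)
    (hunit : 0 < ![(1 : ℝ), 1] ⬝ᵥ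
      (alphaVS (pointFunctional₇ w u v) p q (fun _ _ => (1 : ℝ)) *ᵥ ![(1 : ℝ), 1]))
    (hposS : ∀ Δ ℓ, PS Δ ℓ → (alphaVS (pointFunctional₇ w u v) p q (srcBlockUV Δ ℓ)).PosSemidef)
    (hposT : ∀ Δ ℓ, PT Δ ℓ → 0 ≤ pointFunctional₇ w u v (V7T N p (srcBlockUV Δ ℓ)))
    (hposA : ∀ Δ ℓ, PA Δ ℓ → 0 ≤ pointFunctional₇ w u v (V7A p (srcBlockUV Δ ℓ)))
    (hposV : ∀ Δ ℓ, PV Δ ℓ → 0 ≤ pointFunctional₇ w u v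
      (V7V p q ((-1 : ℝ) ^ ℓ) (srcBlockUVAB (p - q) (p - q) Δ ℓ) (srcBlockUVAB (-(p - q)) (p - q) Δ ℓ))) :
    False := by
  refine not_pointFunctional₇_excludes_gff hN hp hq w u v huv ⟨hunit, ?_, ?_, ?_, ?_, ?_⟩
  · intro nm
    have := hposS _ _ (hPS nm.1 nm.2)
    rwa [srcBlockUV_two_mul] at this
  · intro nm
    have := hposS _ _ (hPS' nm.1 nm.2)
    rwa [srcBlockUV_two_mul] at this
  · intro nm
    have := hposT _ _ (hPT nm.1 nm.2)
    rwa [srcBlockUV_two_mul] at this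
  · exact fun nm => hposA _ _ (hPA nm.1 nm.2)
  · exact fun nl => hposV _ _ (hPV nl.1 nl.2)

/-- **Corollary (gap assumptions below the generalised free lines).** The archipelago-type assumption set —
`S`: even spins above unitarity, scalars `≥ Δ_S^*`; `T`: likewise with `Δ_T^*`; `A`: odd spins above
unitarity; `V`: all spins above unitarity, scalars `≥ Δ_V^*` — evaluated at `(Δ_φ, Δ_s) = (p, q)` with
`Δ_S^* ≤ 2p`, `Δ_S^* ≤ 2q`, `Δ_T^* ≤ 2p`, `Δ_V^* ≤ p + q` admits the decoupled data, so no seven-component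
point functional at diamond points meets the §2.2 conditions: a certificate asserting it is invalid. (At the
archipelago itself `Δ_S^* = Δ_V^* = 3 > 2Δ_φ`: that regime is a genuine exclusion and is not touched.)
[cite: KosPolandSimmonsDuffinVichi2015, §2.2 (functional conditions)] -/
theorem false_of_pointFunctional₇_gaps_le (hN : 2 ≤ N) {p q : ℝ} (hp : 1 / 2 < p) (hq : 1 / 2 < q) {M : ℕ}
    (w : Fin M → Fin 7 → ℝ) (u v : Fin M → ℝ) (huv : ∀ m, InDiamond (u m) (v m)) {ΔS ΔT ΔV : ℝ}
    (hΔS : ΔS ≤ 2 * p) (hΔS' : ΔS ≤ 2 * q) (hΔT : ΔT ≤ 2 * p) (hΔV : ΔV ≤ p + q)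
    (hunit : 0 < ![(1 : ℝ), 1] ⬝ᵥ
      (alphaVS (pointFunctional₇ w u v) p q (fun _ _ => (1 : ℝ)) *ᵥ ![(1 : ℝ), 1]))
    (hposS : ∀ (Δ : ℝ) (ℓ : ℕ), Even ℓ → unitarityBound3D ℓ ≤ Δ → (ℓ = 0 → ΔS ≤ Δ) →
      (alphaVS (pointFunctional₇ w u v) p q (srcBlockUV Δ ℓ)).PosSemidef)
    (hposT : ∀ (Δ : ℝ) (ℓ : ℕ), Even ℓ → unitarityBound3D ℓ ≤ Δ → (ℓ = 0 → ΔT ≤ Δ) →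
      0 ≤ pointFunctional₇ w u v (V7T N p (srcBlockUV Δ ℓ)))
    (hposA : ∀ (Δ : ℝ) (ℓ : ℕ), Odd ℓ → unitarityBound3D ℓ ≤ Δ →
      0 ≤ pointFunctional₇ w u v (V7A p (srcBlockUV Δ ℓ)))
    (hposV : ∀ (Δ : ℝ) (ℓ : ℕ), unitarityBound3D ℓ ≤ Δ → (ℓ = 0 → ΔV ≤ Δ) →
      0 ≤ pointFunctional₇ w u v (V7V p q ((-1 : ℝ) ^ ℓ) (srcBlockUVAB (p - q) (p - q) Δ ℓ)
        (srcBlockUVAB (-(p - q)) (p - q) Δ ℓ))) :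
    False := by
  have hub : ∀ {r : ℝ}, 1 / 2 < r → ∀ n ℓ : ℕ, unitarityBound3D ℓ ≤ 2 * r + 2 * n + ℓ :=
    fun hr n ℓ => (gff_blocks_typed hr n ℓ).1.le
  have hub2 : ∀ {r : ℝ}, 1 / 2 < r → ∀ n m : ℕ, unitarityBound3D (2 * m) ≤ 2 * r + 2 * n + 2 * m := by
    intro r hr n m
    have := hub hr n (2 * m); push_cast at this; exact this
  have hscal : ∀ {r Δ0 : ℝ}, Δ0 ≤ 2 * r → ∀ n m : ℕ, 2 * m = 0 → Δ0 ≤ 2 * r + 2 * n + 2 * m := by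
    intro r Δ0 h0 n m hm
    have hm0 : (m : ℝ) = 0 := by exact_mod_cast (show m = 0 by omega)
    have hn : (0 : ℝ) ≤ n := Nat.cast_nonneg n
    rw [hm0]; linarith
  have hubV : ∀ n ℓ : ℕ, unitarityBound3D ℓ ≤ p + q + 2 * n + ℓ :=
    fun n ℓ => (gffV_blocks_typed hp hq n ℓ).1.le
  have hscalV : ∀ n ℓ : ℕ, ℓ = 0 → ΔV ≤ p + q + 2 * n + ℓ := by
    intro n ℓ hℓ
    subst hℓ
    have hn : (0 : ℝ) ≤ n := Nat.cast_nonneg n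
    push_cast; linarith
  refine false_of_pointFunctional₇_allowing_gff hN hp hq w u v huv
    (fun Δ ℓ => Even ℓ ∧ unitarityBound3D ℓ ≤ Δ ∧ (ℓ = 0 → ΔS ≤ Δ))
    (fun Δ ℓ => Even ℓ ∧ unitarityBound3D ℓ ≤ Δ ∧ (ℓ = 0 → ΔT ≤ Δ))
    (fun Δ ℓ => Odd ℓ ∧ unitarityBound3D ℓ ≤ Δ)
    (fun Δ ℓ => unitarityBound3D ℓ ≤ Δ ∧ (ℓ = 0 → ΔV ≤ Δ)) ?_ ?_ ?_ ?_ ?_ hunit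
    (fun Δ ℓ h => hposS Δ ℓ h.1 h.2.1 h.2.2) (fun Δ ℓ h => hposT Δ ℓ h.1 h.2.1 h.2.2)
    (fun Δ ℓ h => hposA Δ ℓ h.1 h.2) (fun Δ ℓ h => hposV Δ ℓ h.1 h.2)
  · exact fun n m => ⟨even_two_mul m, hub2 hp n m, hscal hΔS n m⟩
  · exact fun n m => ⟨even_two_mul m, hub2 hq n m, hscal hΔS' n m⟩
  · exact fun n m => ⟨even_two_mul m, hub2 hp n m, hscal hΔT n m⟩
  · exact fun n m => ⟨odd_two_mul_add_one m, hub hp n (2 * m + 1)⟩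
  · exact fun n ℓ => ⟨hubV n ℓ, hscalV n ℓ⟩

/-- **The diagonal `Δ_s = Δ_φ = p`.** Both `V` rows then carry the `Δ₁₂ = Δ₃₄ = 0` block
`g^{src} = srcBlockUV` (`srcBlockUVAB_zero_zero`) and all three scalar gaps are compared with `2p`: the
assumption set with `Δ_S^*, Δ_T^*, Δ_V^* ≤ 2p` admits `N + 1` decoupled generalised free fields of one
dimension `p > 1/2`, so no seven-component point functional at diamond points meets the §2.2 conditions.
[cite: KosPolandSimmonsDuffinVichi2015, §2.2 (functional conditions)] -/
theorem false_of_pointFunctional₇_gaps_le_diag (hN : 2 ≤ N) {p : ℝ} (hp : 1 / 2 < p) {M : ℕ}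
    (w : Fin M → Fin 7 → ℝ) (u v : Fin M → ℝ) (huv : ∀ m, InDiamond (u m) (v m)) {ΔS ΔT ΔV : ℝ}
    (hΔS : ΔS ≤ 2 * p) (hΔT : ΔT ≤ 2 * p) (hΔV : ΔV ≤ 2 * p)
    (hunit : 0 < ![(1 : ℝ), 1] ⬝ᵥ
      (alphaVS (pointFunctional₇ w u v) p p (fun _ _ => (1 : ℝ)) *ᵥ ![(1 : ℝ), 1]))
    (hposS : ∀ (Δ : ℝ) (ℓ : ℕ), Even ℓ → unitarityBound3D ℓ ≤ Δ → (ℓ = 0 → ΔS ≤ Δ) →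
      (alphaVS (pointFunctional₇ w u v) p p (srcBlockUV Δ ℓ)).PosSemidef)
    (hposT : ∀ (Δ : ℝ) (ℓ : ℕ), Even ℓ → unitarityBound3D ℓ ≤ Δ → (ℓ = 0 → ΔT ≤ Δ) →
      0 ≤ pointFunctional₇ w u v (V7T N p (srcBlockUV Δ ℓ)))
    (hposA : ∀ (Δ : ℝ) (ℓ : ℕ), Odd ℓ → unitarityBound3D ℓ ≤ Δ →
      0 ≤ pointFunctional₇ w u v (V7A p (srcBlockUV Δ ℓ)))
    (hposV : ∀ (Δ : ℝ) (ℓ : ℕ), unitarityBound3D ℓ ≤ Δ → (ℓ = 0 → ΔV ≤ Δ) →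
      0 ≤ pointFunctional₇ w u v (V7V p p ((-1 : ℝ) ^ ℓ) (srcBlockUV Δ ℓ) (srcBlockUV Δ ℓ))) :
    False := by
  refine false_of_pointFunctional₇_gaps_le hN hp hp w u v huv hΔS hΔS hΔT
    (show ΔV ≤ p + p by linarith) hunit hposS hposT
    hposA fun Δ ℓ h1 h2 => ?_
  have e1 : srcBlockUVAB (p - p) (p - p) Δ ℓ = srcBlockUV Δ ℓ := by
    rw [sub_self, srcBlockUVAB_zero_zero]
  have e2 : srcBlockUVAB (-(p - p)) (p - p) Δ ℓ = srcBlockUV Δ ℓ := by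
    rw [sub_self, neg_zero, srcBlockUVAB_zero_zero]
  rw [e1, e2]
  exact hposV Δ ℓ h1 h2

end

end Literature.MathematicalPhysics.QuantumFieldTheory.ONMixedNonVacuity
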